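import Mathlib.RingTheory.Valuation.ValuationSubring
import Mathlib.RingTheory.LocalRing.ResidueField.Basic
import Mathlib.RingTheory.Ideal.Operations
import Mathlib.RingTheory.Ideal.Maximal
import Mathlib.Algebra.Polynomial.AlgebraMap
import Mathlib.Algebra.Polynomial.BigOperators
import HarnessLib

/-!
# Intersections of finitely many valuation rings and approximation (Bourbaki, AC VI §7)

Topic: `Literature/AlgebraicGeometry/Resolution` (valued function fields). PROVED commutative
algebra from N. Bourbaki, *Algèbre commutative*, Ch. VI (Valuations), §7 "Théorème
d'approximation", nos. 1–2, in the form needed for the **fundamental inequality**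
`∑ᵢ eᵢ fᵢ ≤ n` over all extensions of a valuation to a finite extension (the named fact
`FundamentalInequality` of `GeneralizedStability.lean`, Kuhlmann 2010, §1, (1)): for finitely
many valuation rings `O₁, …, O_n` of a field `L` with intersection `B = ⋂ᵢ Oᵢ` and centres
`𝔭ᵢ = 𝔪(Oᵢ) ∩ B`,

* no. 1, Lemme 1 — for `x ∈ L` there is `z ∈ B` with `zx ∈ B`, a unit at the `Oᵢ ∋ x` and in
  `𝔪ᵢ` (together with `zx`) at the `Oᵢ ∌ x` (`z = f(x)⁻¹` for a monic integer polynomial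
  `f = 1 + X² ∏ fᵢ` with constant term `1`);
* no. 1, Prop. 2 and Cor. 1 — for pairwise INCOMPARABLE `Oᵢ` the `𝔭ᵢ` are exactly the maximal
  ideals of `B`, pairwise distinct, and `B → ∏ᵢ κ(Oᵢ)` is surjective ("pour toute famille
  d'éléments `aᵢ ∈ Aᵢ` il existe `x ∈ B` tel que `x ≡ aᵢ (mod 𝔪(Aᵢ))`");
* no. 2, Thm. 1 (théorème d'approximation) — for pairwise INDEPENDENT `Oᵢ` (`Oᵢ Oⱼ = L`) the
  ideals `𝔮ᵢ = {b ∈ B : vᵢ(b) ≥ αᵢ}` are pairwise comaximal (via Lemme 2: the radical of `𝔮ᵢ`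
  is prime, and `B_{√𝔮ᵢ} ≠ L` would contain `Oᵢ` and `Oⱼ`), whence elements of `B` which are
  units at one `Oᵢ` and as divisible as prescribed at the others.

## Content (everything PROVED)

* `IsFormOne`, `valuation_aeval_of_not_mem`, `exists_isFormOne_aeval_residue_ne_zero`,
  `exists_taming`, `exists_inv_taming` — Lemme 1.
* `interRing O = ⋂ᵢ Oᵢ`, `interIdeal O i = 𝔭ᵢ` (`mem_interIdeal`: `|b|ᵢ < 1`), units of `B`
  (`isUnit_of_forall_not_mem`, `not_mem_interIdeal_of_isUnit`), `interIdeal_isPrime`.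
* For pairwise incomparable `Oᵢ` (`hO : Oᵢ ≤ Oⱼ → i = j`): `exists_mem_interIdeal_not_mem`,
  `interIdeal_le_iff`, `exists_le_interIdeal` (prime avoidance), `interIdeal_isMaximal`,
  `exists_eq_interIdeal`, `interIdeal_sup_interIdeal` — Prop. 2;
  `exists_sub_one_mem_of_sup_eq_top` (Chinese remainder element), `exists_mem_interRing_approx`
  — Cor. 1 (with `aₗ = 0` for `l ≠ i`: `x ≡ b (mod 𝔪ᵢ)`, `x ∈ 𝔪ₗ` for `l ≠ i`).
* For pairwise independent proper `Oᵢ` (`Oᵢ ⊔ Oⱼ = ⊤`): `qIdeal O l e = 𝔮ₗ`,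
  `radical_qIdeal_isPrime` (Lemme 2), `incomparable_of_independent`,
  `exists_bound_mem_interIdeal`, `not_qIdeal_le_interIdeal` and `qIdeal_sup_qIdeal` (the heart
  of Thm. 1), `exists_unit_valuation_le` — Thm. 1 in the form: for each `i` and non-zero `dₗ`
  there is `u ∈ B` with `|u|ᵢ = 1` and `|u|ₗ ≤ |dₗ|ₗ` for `l ≠ i`.

## Source

* N. Bourbaki, *Algèbre commutative, Chapitres 5 à 7* (Hermann 1975; Springer 2006), Ch. VI
  §7, no. 1 (Lemme 1, Prop. 1, Prop. 2, Cor. 1–3) and no. 2 (Déf. 1, Thm. 1, Lemme 2, Cor. 1).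

## Rendering notes

* Valuations are Mathlib's multiplicative `Oᵢ.valuation` (`≤ 1` on `Oᵢ`, `< 1` on `𝔪ᵢ`), so
  Bourbaki's "`vᵢ(z) ≥ αᵢ`" reads `|z|ᵢ ≤ |d|ᵢ` for an element `d` realising the bound.
* "Independent" (Déf. 1: "`K` est l'anneau engendré par `A` et `A'`") is `Oᵢ ⊔ Oⱼ = ⊤` in the
  semilattice `ValuationSubring L` (the sup is the subring generated, an overring of `Oᵢ`).
* Prop. 1 (`Aᵢ = B_{𝔭ᵢ}`) is not stated as such; its uses go through `exists_inv_taming`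
  directly (`x = (zx)/z` with `z ∉ 𝔭ᵢ`).
-/

noncomputable section

open IsLocalRing Polynomial

namespace Literature.AlgebraicGeometry.Resolution

universe u v

variable {L : Type u} [Field L] {ι : Type v} (O : ι → ValuationSubring L)

/-! ### Bourbaki's Lemma 1: taming an element simultaneously at finitely many valuations -/

section Lemma1

/-- Integer polynomials "of the form (1)" of Bourbaki, *Alg. Comm.* VI §7 no. 1, Lemma 1:
monic with constant coefficient `1`. [folklore] -/
def IsFormOne (g : ℤ[X]) : Prop := g.Monic ∧ g.coeff 0 = 1

/-- For `x ∉ O`, a monic integer polynomial `f` of degree `k` has `|f(x)| = |x|^k`. [folklore] -/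
theorem valuation_aeval_of_not_mem (A : ValuationSubring L) {x : L} (hx : x ∉ A) {f : ℤ[X]}
    (hf : f.Monic) : A.valuation (aeval x f) = A.valuation x ^ f.natDegree := by
  classical
  have hx1 : 1 < A.valuation x := by
    rw [← not_le]; exact fun h => hx ((A.valuation_le_one_iff x).mp h)
  rw [aeval_eq_sum_range]
  have hmem : f.natDegree ∈ Finset.range (f.natDegree + 1) := Finset.self_mem_range_succ _
  rw [A.valuation.map_sum_eq_of_lt hmem]
  · rw [hf.coeff_natDegree, one_smul, map_pow]
  · intro j hj
    rw [Finset.mem_sdiff, Finset.mem_range, Finset.mem_singleton] at hj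
    have hjlt : j < f.natDegree := lt_of_le_of_ne (Nat.lt_succ_iff.mp hj.1) hj.2
    rw [hf.coeff_natDegree, one_smul, map_pow, zsmul_eq_mul, map_mul, map_pow]
    have hint : A.valuation ((f.coeff j : ℤ) : L) ≤ 1 :=
      (A.valuation_le_one_iff _).mpr (intCast_mem A _)
    calc A.valuation ((f.coeff j : ℤ) : L) * A.valuation x ^ j
        ≤ 1 * A.valuation x ^ j := by gcongr
      _ = A.valuation x ^ j := one_mul _
      _ < A.valuation x ^ f.natDegree := pow_lt_pow_right₀ hx1 hjlt

variable [Fintype ι]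

/-- **Bourbaki, *Alg. Comm.* VI §7 no. 1, Lemme 1** (the polynomial): for valuation rings
`O₁, …, O_n` of a field `L` and `x ∈ L` there is a monic integer polynomial `f` with constant
term `1` and degree `≥ 2` such that `f(x̄ᵢ) ≠ 0` in the residue field of every `Oᵢ` containing
`x` (`f = 1 + X² ∏ᵢ fᵢ`, where `fᵢ` is a polynomial of the form (1) killing `x̄ᵢ` if there is
one, and `1` otherwise). PROVED. [cite: BourbakiAC5to7, Ch. VI §7 no. 1, Lemme 1] -/
theorem exists_isFormOne_aeval_residue_ne_zero (x : L) :
    ∃ f : ℤ[X], IsFormOne f ∧ 2 ≤ f.natDegree ∧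
      ∀ i, ∀ hx : x ∈ O i, aeval (residue (O i) ⟨x, hx⟩) f ≠ 0 := by
  classical
  -- `fᵢ`: a polynomial of the form (1) killing `x̄ᵢ`, if there is one
  have key : ∀ i, ∃ g : ℤ[X], IsFormOne g ∧ ∀ hx : x ∈ O i,
      (∃ g' : ℤ[X], IsFormOne g' ∧ aeval (residue (O i) ⟨x, hx⟩) g' = 0) →
        aeval (residue (O i) ⟨x, hx⟩) g = 0 := by
    intro i
    by_cases h : ∃ hx : x ∈ O i, ∃ g : ℤ[X], IsFormOne g ∧ aeval (residue (O i) ⟨x, hx⟩) g = 0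
    · obtain ⟨hx, g, hg, hg0⟩ := h
      exact ⟨g, hg, fun _ _ => hg0⟩
    · refine ⟨1, ⟨monic_one, by simp⟩, fun hx h' => ?_⟩
      exact (h ⟨hx, h'⟩).elim
  choose fi hfi hkill using key
  let P : ℤ[X] := ∏ i, fi i
  have hP : P.Monic := monic_prod_of_monic _ _ fun i _ => (hfi i).1
  let Q : ℤ[X] := X ^ 2 * P
  have hQ : Q.Monic := (monic_X_pow 2).mul hP
  have hQdeg : Q.natDegree = 2 + P.natDegree := by
    change (X ^ 2 * P).natDegree = _
    rw [(monic_X_pow 2).natDegree_mul hP, natDegree_X_pow]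
  have hlt : (1 : ℤ[X]).degree < Q.degree := by
    rw [degree_one, degree_eq_natDegree hQ.ne_zero, hQdeg]
    exact_mod_cast Nat.zero_lt_two.trans_le le_self_add
  let f : ℤ[X] := 1 + Q
  have hfm : f.Monic := hQ.add_of_right hlt
  have hfdeg : f.natDegree = 2 + P.natDegree := by
    change (1 + Q).natDegree = _
    rw [natDegree_add_eq_right_of_degree_lt hlt, hQdeg]
  have hf0 : f.coeff 0 = 1 := by
    change (1 + X ^ 2 * P).coeff 0 = 1
    rw [coeff_add, coeff_one_zero, mul_coeff_zero, coeff_X_pow]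
    simp
  refine ⟨f, ⟨hfm, hf0⟩, by rw [hfdeg]; exact le_self_add, fun i hx h0 => ?_⟩
  -- if `f(x̄ᵢ) = 0` then `fᵢ(x̄ᵢ) = 0`, so `f(x̄ᵢ) = 1`
  have hi : aeval (residue (O i) ⟨x, hx⟩) (fi i) = 0 := hkill i hx ⟨f, ⟨hfm, hf0⟩, h0⟩
  have hPi : aeval (residue (O i) ⟨x, hx⟩) P = 0 := by
    change aeval _ (∏ l, fi l) = 0
    rw [map_prod]
    exact Finset.prod_eq_zero (Finset.mem_univ i) hi
  have h1 : aeval (residue (O i) ⟨x, hx⟩) f = 1 := by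
    change aeval _ (1 + X ^ 2 * P) = 1
    rw [map_add, map_one, map_mul, hPi, mul_zero, add_zero]
  rw [h1] at h0
  exact one_ne_zero h0

/-- **Bourbaki, *Alg. Comm.* VI §7 no. 1, Lemme 1** (the taming element): for valuation rings
`O₁, …, O_n` of `L` and `x ∈ L` there is `y ∈ L` (`y = f(x)` for the polynomial above) which
is a UNIT of every `Oᵢ` containing `x` and satisfies `|y|ᵢ = |x|ᵢ^k` with `k ≥ 2` at every `Oᵢ`
not containing `x`; so `z = y⁻¹` has "`vᵢ(z) = 0` si `vᵢ(x) ≥ 0`, `vᵢ(z) + vᵢ(x) > 0` si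
`vᵢ(x) < 0`". PROVED. [cite: BourbakiAC5to7, Ch. VI §7 no. 1, Lemme 1] -/
theorem exists_taming (x : L) :
    ∃ (y : L) (k : ℕ), 2 ≤ k ∧ (∀ i, x ∈ O i → (O i).valuation y = 1) ∧
      (∀ i, x ∉ O i → (O i).valuation y = (O i).valuation x ^ k) := by
  obtain ⟨f, ⟨hfm, -⟩, hdeg, hres⟩ := exists_isFormOne_aeval_residue_ne_zero O x
  refine ⟨aeval x f, f.natDegree, hdeg, fun i hx => ?_, fun i hx => ?_⟩
  · -- `f(x)` is a unit of `Oᵢ`: its residue is `f(x̄ᵢ) ≠ 0`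
    have hunit : IsUnit (aeval (⟨x, hx⟩ : O i) f) := by
      rw [← residue_ne_zero_iff_isUnit]
      have h := aeval_algHom_apply (residue (O i)).toIntAlgHom (⟨x, hx⟩ : O i) f
      rw [RingHom.toIntAlgHom_apply] at h
      -- `h : aeval (residue ⟨x, hx⟩) f = residue (aeval ⟨x, hx⟩ f)`
      rw [← show aeval (residue (O i) ⟨x, hx⟩) f = residue (O i) (aeval (⟨x, hx⟩ : O i) f)
        from h]
      exact hres i hx
    have hcoe : aeval x f = ((aeval (⟨x, hx⟩ : O i) f : O i) : L) := by
      have h := aeval_algHom_apply (O i).subtype.toIntAlgHom (⟨x, hx⟩ : O i) f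
      rw [RingHom.toIntAlgHom_apply] at h
      exact h
    rw [hcoe]
    exact (O i).valuation_unit hunit.unit
  · exact valuation_aeval_of_not_mem (O i) hx hfm

end Lemma1

/-! ### The intersection `B = ⋂ᵢ Oᵢ` and its ideals `𝔭ᵢ = 𝔪(Oᵢ) ∩ B` -/

section Intersection

/-- `B = ⋂ᵢ Oᵢ`, the intersection of finitely many valuation rings of `L`
(Bourbaki, *Alg. Comm.* VI §7 no. 1). [folklore] -/
def interRing : Subring L := ⨅ i, (O i).toSubring

/-- Membership in `B = ⋂ᵢ Oᵢ`. [folklore] -/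
theorem mem_interRing {x : L} : x ∈ interRing O ↔ ∀ i, x ∈ O i := by
  simp [interRing, Subring.mem_iInf]

/-- Elements of `B` have value `≤ 1` everywhere. [folklore] -/
theorem valuation_coe_le_one (b : interRing O) (i : ι) : (O i).valuation (b : L) ≤ 1 :=
  ((O i).valuation_le_one_iff _).mpr ((mem_interRing O).mp b.2 i)

/-- `𝔭ᵢ = 𝔪(Oᵢ) ∩ B`, the centre of `Oᵢ` on `B` (Bourbaki, loc. cit.). [folklore] -/
def interIdeal (i : ι) : Ideal (interRing O) where
  carrier := {b | (O i).valuation (b : L) < 1}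
  add_mem' {a b} ha hb := by
    change (O i).valuation ((a : L) + b) < 1
    exact Valuation.map_add_lt _ ha hb
  zero_mem' := by
    change (O i).valuation ((0 : interRing O) : L) < 1
    rw [ZeroMemClass.coe_zero, map_zero]
    exact zero_lt_one
  smul_mem' c {b} hb := by
    change (O i).valuation ((c : L) * b) < 1
    rw [map_mul]
    calc (O i).valuation (c : L) * (O i).valuation (b : L)
        ≤ 1 * (O i).valuation (b : L) := by gcongr; exact valuation_coe_le_one O c i
      _ < 1 := by rw [one_mul]; exact hb

/-- Membership in `𝔭ᵢ`: `|b|ᵢ < 1`. [folklore] -/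
theorem mem_interIdeal {i : ι} {b : interRing O} :
    b ∈ interIdeal O i ↔ (O i).valuation (b : L) < 1 := Iff.rfl

/-- Non-membership in `𝔭ᵢ`: `|b|ᵢ = 1` (elements of `B` have `|b|ᵢ ≤ 1`). [folklore] -/
theorem not_mem_interIdeal {i : ι} {b : interRing O} :
    b ∉ interIdeal O i ↔ (O i).valuation (b : L) = 1 := by
  rw [mem_interIdeal, not_lt]
  exact ⟨fun h => le_antisymm (valuation_coe_le_one O b i) h, fun h => h.ge⟩

/-- An element of `B` outside every `𝔭ᵢ` is a unit of `B`. [folklore] -/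
theorem isUnit_of_forall_not_mem [Nonempty ι] {b : interRing O} (hb : ∀ i, b ∉ interIdeal O i) :
    IsUnit b := by
  obtain ⟨i⟩ := ‹Nonempty ι›
  have hb0 : (b : L) ≠ 0 := fun h => by
    have := (not_mem_interIdeal O).mp (hb i)
    rw [h, map_zero] at this
    exact zero_ne_one this
  have hinv : (b : L)⁻¹ ∈ interRing O := by
    refine (mem_interRing O).mpr fun l => ((O l).valuation_le_one_iff _).mp ?_
    rw [map_inv₀, (not_mem_interIdeal O).mp (hb l), inv_one]
  exact IsUnit.of_mul_eq_one (b := ⟨(b : L)⁻¹, hinv⟩) (Subtype.ext (mul_inv_cancel₀ hb0))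

/-- A unit of `B` lies outside every `𝔭ᵢ`. [folklore] -/
theorem not_mem_interIdeal_of_isUnit {b : interRing O} (hb : IsUnit b) (i : ι) :
    b ∉ interIdeal O i := by
  rw [not_mem_interIdeal]
  obtain ⟨u, rfl⟩ := hb
  apply le_antisymm (valuation_coe_le_one O _ i)
  have h1 : (O i).valuation ((u : interRing O) : L) *
      (O i).valuation ((↑u⁻¹ : interRing O) : L) = 1 := by
    rw [← map_mul, ← Subring.coe_mul, Units.mul_inv, OneMemClass.coe_one, map_one]
  calc (1 : (O i).ValueGroup) = _ := h1.symm
    _ ≤ (O i).valuation ((u : interRing O) : L) * 1 := by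
        gcongr; exact valuation_coe_le_one O _ i
    _ = _ := mul_one _

/-- `𝔭ᵢ` is a prime ideal. [folklore] -/
theorem interIdeal_isPrime (i : ι) : (interIdeal O i).IsPrime := by
  refine ⟨fun h => ?_, fun {a b} hab => ?_⟩
  · have h1 : (1 : interRing O) ∈ interIdeal O i := by rw [h]; trivial
    rw [mem_interIdeal, OneMemClass.coe_one, map_one] at h1
    exact lt_irrefl _ h1
  · rw [mem_interIdeal, Subring.coe_mul, map_mul] at hab
    by_contra hor
    push Not at hor
    rw [not_mem_interIdeal O, not_mem_interIdeal O] at hor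
    rw [hor.1, hor.2, mul_one] at hab
    exact lt_irrefl _ hab

/-- **Lemma 1 in its usual form**: for `x ∈ L` there is `z ∈ B = ⋂ᵢ Oᵢ` with `zx ∈ B`, which is
a unit at every `Oᵢ ∋ x` and satisfies `z, zx ∈ 𝔪ᵢ` at every `Oᵢ ∌ x` (Bourbaki, *Alg. Comm.*
VI §7 no. 1, Lemme 1: "`vᵢ(z) = 0` si `vᵢ(x) ≥ 0`, `vᵢ(z) + vᵢ(x) > 0` si `vᵢ(x) < 0`").
PROVED. [cite: BourbakiAC5to7, Ch. VI §7 no. 1, Lemme 1] -/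
theorem exists_inv_taming [Fintype ι] (x : L) :
    ∃ z : L, z ∈ interRing O ∧ z * x ∈ interRing O ∧ (Nonempty ι → z ≠ 0) ∧
      (∀ i, x ∈ O i → (O i).valuation z = 1) ∧
      (∀ i, x ∉ O i → (O i).valuation z < 1 ∧ (O i).valuation (z * x) < 1) := by
  obtain ⟨y, k, hk, hunit, hnot⟩ := exists_taming O x
  have hgt : ∀ i, x ∉ O i → 1 < (O i).valuation x := fun i hx => by
    rw [← not_le]; exact fun h => hx (((O i).valuation_le_one_iff x).mp h)
  have hy0 : Nonempty ι → y ≠ 0 := by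
    rintro ⟨i⟩ rfl
    by_cases hx : x ∈ O i
    · have := hunit i hx
      rw [map_zero] at this
      exact zero_ne_one this
    · have := hnot i hx
      rw [map_zero] at this
      exact (pow_pos (zero_lt_one.trans (hgt i hx)) k).ne' this.symm
  have hzin : ∀ i, x ∈ O i → (O i).valuation y⁻¹ = 1 := fun i hx => by
    rw [map_inv₀, hunit i hx, inv_one]
  have hzout : ∀ i, x ∉ O i → (O i).valuation y⁻¹ < 1 ∧ (O i).valuation (y⁻¹ * x) < 1 := by
    intro i hx
    have h1 := hgt i hx
    have hyk := hnot i hx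
    have hypos : 0 < (O i).valuation y := by rw [hyk]; exact pow_pos (zero_lt_one.trans h1) k
    have hxlt : (O i).valuation x < (O i).valuation y := by
      rw [hyk]
      calc (O i).valuation x = (O i).valuation x ^ 1 := (pow_one _).symm
        _ < (O i).valuation x ^ k := pow_lt_pow_right₀ h1 (by omega)
    constructor
    · rw [map_inv₀, inv_lt_one₀ hypos]
      exact h1.trans hxlt
    · rw [map_mul, map_inv₀, inv_mul_lt_one₀ hypos]
      exact hxlt
  refine ⟨y⁻¹, ?_, ?_, fun h => inv_ne_zero (hy0 h), hzin, hzout⟩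
  · refine (mem_interRing O).mpr fun i => ((O i).valuation_le_one_iff _).mp ?_
    by_cases hx : x ∈ O i
    · exact (hzin i hx).le
    · exact (hzout i hx).1.le
  · refine (mem_interRing O).mpr fun i => ((O i).valuation_le_one_iff _).mp ?_
    by_cases hx : x ∈ O i
    · rw [map_mul, hzin i hx, one_mul]
      exact ((O i).valuation_le_one_iff x).mpr hx
    · exact (hzout i hx).2.le

variable (hO : ∀ i j, O i ≤ O j → i = j)
include hO

/-- For pairwise incomparable `Oᵢ`, `𝔭ᵢ ⊄ 𝔭ⱼ` for `i ≠ j` (Bourbaki, *Alg. Comm.* VI §7 no. 1,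
Prop. 2). PROVED (Lemma 1 applied to an element of `Oⱼ ∖ Oᵢ`).
[cite: BourbakiAC5to7, Ch. VI §7 no. 1, Prop. 2] -/
theorem exists_mem_interIdeal_not_mem [Fintype ι] {i j : ι} (hij : i ≠ j) :
    ∃ z : interRing O, z ∈ interIdeal O i ∧ z ∉ interIdeal O j := by
  have hnle : ¬ O j ≤ O i := fun h => hij (hO j i h).symm
  obtain ⟨y, hyj, hyi⟩ := SetLike.not_le_iff_exists.mp hnle
  obtain ⟨z, hzB, -, -, hin, hout⟩ := exists_inv_taming O y
  exact ⟨⟨z, hzB⟩, (mem_interIdeal O).mpr (hout i hyi).1,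
    (not_mem_interIdeal O).mpr (hin j hyj)⟩

/-- The `𝔭ᵢ` are pairwise incomparable, in particular pairwise distinct. [folklore] -/
theorem interIdeal_le_iff [Fintype ι] {i j : ι} : interIdeal O i ≤ interIdeal O j ↔ i = j := by
  refine ⟨fun h => ?_, by rintro rfl; exact le_rfl⟩
  by_contra hij
  obtain ⟨z, hzi, hzj⟩ := exists_mem_interIdeal_not_mem O hO hij
  exact hzj (h hzi)

omit hO in
/-- A proper ideal of `B` lies in some `𝔭ᵢ` (its elements are non-units, i.e. lie in `⋃ᵢ 𝔭ᵢ`;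
prime avoidance). [folklore] -/
theorem exists_le_interIdeal [Fintype ι] [Nonempty ι] {J : Ideal (interRing O)} (hJ : J ≠ ⊤) :
    ∃ i, J ≤ interIdeal O i := by
  classical
  obtain ⟨i₀⟩ := ‹Nonempty ι›
  have hsub : (J : Set (interRing O)) ⊆ ⋃ i ∈ (↑(Finset.univ : Finset ι) : Set ι),
      (interIdeal O i : Set (interRing O)) := by
    intro b hb
    by_contra hnot
    simp only [Finset.coe_univ, Set.mem_univ, Set.iUnion_true, Set.mem_iUnion, SetLike.mem_coe,
      not_exists] at hnot
    exact hJ (Ideal.eq_top_of_isUnit_mem J hb (isUnit_of_forall_not_mem O hnot))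
  obtain ⟨i, -, hi⟩ := (Ideal.subset_union_prime i₀ i₀ fun i _ _ _ =>
    interIdeal_isPrime O i).mp hsub
  exact ⟨i, hi⟩

/-- For pairwise incomparable `Oᵢ`, `𝔭ᵢ` is a maximal ideal of `B` (Bourbaki, *Alg. Comm.*
VI §7 no. 1, Prop. 2). PROVED. [cite: BourbakiAC5to7, Ch. VI §7 no. 1, Prop. 2] -/
theorem interIdeal_isMaximal [Fintype ι] (i : ι) : (interIdeal O i).IsMaximal := by
  haveI : Nonempty ι := ⟨i⟩
  refine ⟨⟨(interIdeal_isPrime O i).ne_top, fun J hJ => ?_⟩⟩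
  by_contra hJtop
  obtain ⟨l, hl⟩ := exists_le_interIdeal O hJtop
  have hil : i = l := (interIdeal_le_iff O hO).mp (hJ.le.trans hl)
  subst hil
  exact hJ.ne (le_antisymm hJ.le hl)

omit hO in
/-- Every maximal ideal of `B` is one of the `𝔭ᵢ` (Bourbaki, *Alg. Comm.* VI §7 no. 1, Prop. 2).
PROVED. [cite: BourbakiAC5to7, Ch. VI §7 no. 1, Prop. 2] -/
theorem exists_eq_interIdeal [Fintype ι] [Nonempty ι] (M : Ideal (interRing O)) (hM : M.IsMaximal) :
    ∃ i, M = interIdeal O i := by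
  obtain ⟨i, hi⟩ := exists_le_interIdeal O hM.ne_top
  exact ⟨i, hM.eq_of_le (interIdeal_isPrime O i).ne_top hi⟩

/-- Distinct `𝔭ᵢ` are comaximal. [folklore] -/
theorem interIdeal_sup_interIdeal [Fintype ι] {i j : ι} (hij : i ≠ j) :
    interIdeal O i ⊔ interIdeal O j = ⊤ :=
  (interIdeal_isMaximal O hO i).coprime_of_ne (interIdeal_isMaximal O hO j)
    fun h => hij ((interIdeal_le_iff O hO).mp h.le)

omit hO in
/-- Chinese-remainder element: for ideals `Qₗ` with `Qᵢ + Qₗ = R` (`l ≠ i`) there is `w ∈ R`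
with `w ≡ 1 (mod Qᵢ)` and `w ∈ Qₗ` for all `l ≠ i` (the product of elements `yₗ ∈ Qₗ`,
`yₗ ≡ 1 (mod Qᵢ)`). [folklore] -/
theorem exists_sub_one_mem_of_sup_eq_top [Fintype ι] {R : Type*} [CommRing R] (Q : ι → Ideal R)
    (i : ι) (h : ∀ l, l ≠ i → Q i ⊔ Q l = ⊤) :
    ∃ w : R, w - 1 ∈ Q i ∧ ∀ l, l ≠ i → w ∈ Q l := by
  classical
  have hcop : ∀ l, ∃ w : R, (l ≠ i → w ∈ Q l) ∧ w - 1 ∈ Q i := by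
    intro l
    by_cases hl : l = i
    · exact ⟨1, fun h => (h hl).elim, by rw [sub_self]; exact zero_mem _⟩
    · obtain ⟨a, ha, w, hw, haw⟩ := Submodule.mem_sup.mp
        (show (1 : R) ∈ Q i ⊔ Q l from (h l hl) ▸ trivial)
      refine ⟨w, fun _ => hw, ?_⟩
      have : w - 1 = -a := by rw [← haw]; ring
      rw [this]
      exact neg_mem ha
  choose w hwl hwi using hcop
  refine ⟨∏ l ∈ Finset.univ.erase i, w l, ?_, fun l hl => ?_⟩
  · rw [← Ideal.Quotient.eq_zero_iff_mem, map_sub, map_one, map_prod, sub_eq_zero]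
    refine Finset.prod_eq_one fun l _ => ?_
    have h := hwi l
    rw [← Ideal.Quotient.eq_zero_iff_mem, map_sub, map_one, sub_eq_zero] at h
    exact h
  · rw [← Finset.mul_prod_erase _ _ (Finset.mem_erase.mpr ⟨hl, Finset.mem_univ l⟩)]
    exact Ideal.mul_mem_right _ _ (hwl l hl)

/-- An element of `B` which is `≡ 1 (mod 𝔭ᵢ)` and lies in `𝔭ₗ` for all `l ≠ i`. [folklore] -/
theorem exists_sub_one_mem_and_mem [Fintype ι] (i : ι) :
    ∃ w : interRing O, w - 1 ∈ interIdeal O i ∧ ∀ l, l ≠ i → w ∈ interIdeal O l :=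
  exists_sub_one_mem_of_sup_eq_top _ i fun _ hl => interIdeal_sup_interIdeal O hO (Ne.symm hl)

/-- **Residue approximation in `B = ⋂ᵢ Oᵢ`** (Bourbaki, *Alg. Comm.* VI §7 no. 1, Cor. 1 of
Prop. 2: "Pour toute famille d'éléments `aᵢ ∈ Aᵢ` il existe `x ∈ B` tel que `x ≡ aᵢ
(mod 𝔪(Aᵢ))`", in the case `aₗ = 0` for `l ≠ i`): for pairwise incomparable valuation rings
`O₁, …, O_n` of `L`, an index `i` and `b ∈ Oᵢ` there is `x ∈ ⋂ₗ Oₗ` with `x ≡ b (mod 𝔪ᵢ)` and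
`x ∈ 𝔪ₗ` for all `l ≠ i`. PROVED. [cite: BourbakiAC5to7, Ch. VI §7 no. 1, Cor. 1 de la Prop. 2] -/
theorem exists_mem_interRing_approx [Fintype ι] (i : ι) {b : L} (hb : b ∈ O i) :
    ∃ x : L, x ∈ interRing O ∧ (O i).valuation (x - b) < 1 ∧
      ∀ l, l ≠ i → (O l).valuation x < 1 := by
  haveI : Nonempty ι := ⟨i⟩
  obtain ⟨z, hzB, hzbB, -, hin, -⟩ := exists_inv_taming O b
  have hzi : (⟨z, hzB⟩ : interRing O) ∉ interIdeal O i := (not_mem_interIdeal O).mpr (hin i hb)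
  obtain ⟨y, c, hc, hyc⟩ := (interIdeal_isMaximal O hO i).exists_inv hzi
  obtain ⟨w, hwi, hwl⟩ := exists_sub_one_mem_and_mem O hO i
  let x₀ : interRing O := y * ⟨z * b, hzbB⟩
  refine ⟨((x₀ * w : interRing O) : L), (x₀ * w).2, ?_, fun l hl => ?_⟩
  · have hsplit : ((x₀ * w : interRing O) : L) - b =
        (x₀ : L) * ((w - 1 : interRing O) : L) + -(((c : interRing O) : L) * b) := by
      have h1 : ((y : interRing O) : L) * z + (c : L) = 1 := by
        have := congrArg (fun t : interRing O => (t : L)) hyc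
        simpa using this
      simp only [x₀, Subring.coe_mul, AddSubgroupClass.coe_sub, OneMemClass.coe_one]
      linear_combination b * h1
    rw [hsplit]
    refine Valuation.map_add_lt _ ?_ ?_
    · rw [map_mul]
      calc (O i).valuation (x₀ : L) * (O i).valuation ((w - 1 : interRing O) : L)
          ≤ 1 * (O i).valuation ((w - 1 : interRing O) : L) := by
            gcongr; exact valuation_coe_le_one O _ i
        _ < 1 := by rw [one_mul]; exact hwi
    · rw [Valuation.map_neg, map_mul]
      calc (O i).valuation ((c : interRing O) : L) * (O i).valuation b
          ≤ (O i).valuation ((c : interRing O) : L) * 1 := by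
            gcongr; exact ((O i).valuation_le_one_iff b).mpr hb
        _ < 1 := by rw [mul_one]; exact hc
  · exact (mem_interIdeal O).mp (Ideal.mul_mem_left _ _ (hwl l hl))

end Intersection

/-! ### Pairwise independent valuation rings: approximation (Bourbaki VI §7 no. 2, Thm. 1) -/

section Independent

variable [Fintype ι]

/-- The ideal `{b ∈ B | |b|ₗ ≤ |e|ₗ}` of `B` of elements at least as divisible at `Oₗ` as a
given `e ∈ L` (Bourbaki's `𝔮ₗ`). [folklore] -/
def qIdeal (l : ι) (e : L) : Ideal (interRing O) where
  carrier := {b | (O l).valuation (b : L) ≤ (O l).valuation e}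
  add_mem' {a b} ha hb := by
    show (O l).valuation ((a : L) + b) ≤ (O l).valuation e
    exact Valuation.map_add_le _ ha hb
  zero_mem' := by
    show (O l).valuation ((0 : interRing O) : L) ≤ (O l).valuation e
    rw [ZeroMemClass.coe_zero, map_zero]
    exact zero_le
  smul_mem' c {b} hb := by
    show (O l).valuation ((c : L) * b) ≤ (O l).valuation e
    rw [map_mul]
    calc (O l).valuation (c : L) * (O l).valuation (b : L)
        ≤ 1 * (O l).valuation (b : L) := by gcongr; exact valuation_coe_le_one O c l
      _ ≤ _ := by rw [one_mul]; exact hb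

omit [Fintype ι] in
/-- Membership in `𝔮ₗ`. [folklore] -/
theorem mem_qIdeal {l : ι} {e : L} {b : interRing O} :
    b ∈ qIdeal O l e ↔ (O l).valuation (b : L) ≤ (O l).valuation e := Iff.rfl

omit [Fintype ι] in
/-- `𝔮ₗ ⊆ 𝔭ₗ` when `|e|ₗ < 1`. [folklore] -/
theorem qIdeal_le_interIdeal {l : ι} {e : L} (he : (O l).valuation e < 1) :
    qIdeal O l e ≤ interIdeal O l := fun _ hb => lt_of_le_of_lt hb he

omit [Fintype ι] in
/-- The radical of `𝔮ₗ` is a prime ideal (Bourbaki, *Alg. Comm.* VI §7 no. 2, Lemme 2: in a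
valuation ring the radical of a proper ideal is prime). PROVED.
[cite: BourbakiAC5to7, Ch. VI §7 no. 2, Lemme 2] -/
theorem radical_qIdeal_isPrime {l : ι} {e : L} (he : (O l).valuation e < 1) :
    (qIdeal O l e).radical.IsPrime := by
  refine ⟨fun h => ?_, fun {a b} hab => ?_⟩
  · rw [Ideal.radical_eq_top] at h
    have h1 : (1 : interRing O) ∈ qIdeal O l e := by rw [h]; trivial
    rw [mem_qIdeal, OneMemClass.coe_one, map_one] at h1
    exact not_lt.mpr h1 he
  · obtain ⟨n, hn⟩ := hab
    rw [mem_qIdeal, Subring.coe_pow, Subring.coe_mul, map_pow, map_mul] at hn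
    rcases le_total ((O l).valuation (a : L)) ((O l).valuation (b : L)) with hle | hle
    · refine Or.inl ⟨2 * n, ?_⟩
      rw [mem_qIdeal, Subring.coe_pow, map_pow, pow_mul, sq]
      calc ((O l).valuation (a : L) * (O l).valuation (a : L)) ^ n
          ≤ ((O l).valuation (a : L) * (O l).valuation (b : L)) ^ n := by gcongr
        _ ≤ _ := hn
    · refine Or.inr ⟨2 * n, ?_⟩
      rw [mem_qIdeal, Subring.coe_pow, map_pow, pow_mul, sq]
      calc ((O l).valuation (b : L) * (O l).valuation (b : L)) ^ n
          ≤ ((O l).valuation (a : L) * (O l).valuation (b : L)) ^ n := by gcongr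
        _ ≤ _ := hn

variable (hne : ∀ i, O i ≠ ⊤) (hind : ∀ i j, i ≠ j → O i ⊔ O j = ⊤)
include hne hind

omit [Fintype ι] hne in
/-- Pairwise independent proper valuation rings are pairwise incomparable. [folklore] -/
theorem incomparable_of_independent (hne : ∀ i, O i ≠ ⊤) : ∀ i j, O i ≤ O j → i = j := by
  intro i j hij
  by_contra h
  have := hind i j h
  rw [sup_eq_right.mpr hij] at this
  exact hne j this

omit hind in
/-- `𝔭ₗ ≠ 0`: there is a non-zero element of `B` in `𝔪ₗ`. [folklore] -/
theorem exists_mem_interIdeal_ne_zero (l : ι) :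
    ∃ t : interRing O, t ∈ interIdeal O l ∧ (t : L) ≠ 0 := by
  haveI : Nonempty ι := ⟨l⟩
  obtain ⟨y, hy⟩ : ∃ y : L, y ∉ O l := by
    by_contra h
    push Not at h
    exact hne l (eq_top_iff.mpr fun y _ => h y)
  obtain ⟨z, hzB, -, hz0, -, hout⟩ := exists_inv_taming O y
  exact ⟨⟨z, hzB⟩, (mem_interIdeal O).mpr (hout l hy).1, hz0 inferInstance⟩

omit hind in
/-- Bounds can be realised inside `𝔭ₗ`: for `d ≠ 0` there is `0 ≠ d' ∈ 𝔭ₗ` with `|d'|ₗ ≤ |d|ₗ`.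
[folklore] -/
theorem exists_bound_mem_interIdeal (l : ι) {d : L} (hd : d ≠ 0) :
    ∃ d' : interRing O, (d' : L) ≠ 0 ∧ d' ∈ interIdeal O l ∧
      (O l).valuation (d' : L) ≤ (O l).valuation d := by
  haveI : Nonempty ι := ⟨l⟩
  obtain ⟨z, hzB, hzdB, hz0, -, -⟩ := exists_inv_taming O d⁻¹
  obtain ⟨t, ht, ht0⟩ := exists_mem_interIdeal_ne_zero O hne l
  have hzle : (O l).valuation z ≤ (O l).valuation d := by
    have h1 : (O l).valuation (z * d⁻¹) ≤ 1 :=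
      ((O l).valuation_le_one_iff _).mpr ((mem_interRing O).mp hzdB l)
    rw [map_mul, map_inv₀] at h1
    have hd' : (O l).valuation d ≠ 0 := (Valuation.ne_zero_iff _).mpr hd
    rwa [mul_inv_le_iff₀ (zero_lt_iff.mpr hd'), one_mul] at h1
  refine ⟨⟨z, hzB⟩ * t, mul_ne_zero (hz0 inferInstance) ht0, Ideal.mul_mem_left _ _ ht, ?_⟩
  rw [Subring.coe_mul, map_mul]
  calc (O l).valuation z * (O l).valuation (t : L) ≤ (O l).valuation z * 1 := by
        gcongr; exact valuation_coe_le_one O t l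
    _ ≤ (O l).valuation d := by rw [mul_one]; exact hzle

/-- The heart of the approximation theorem (Bourbaki, *Alg. Comm.* VI §7 no. 2, proof of
Thm. 1): for INDEPENDENT `Oᵢ, Oₗ` (`i ≠ l`) and `0 ≠ d ∈ 𝔭ᵢ`, the ideal `𝔮ᵢ = {b : |b|ᵢ ≤ |d|ᵢ}`
is not contained in `𝔭ₗ`: otherwise the local ring `B_𝔯`, `𝔯 = √𝔮ᵢ ⊆ 𝔭ᵢ ∩ 𝔭ₗ`, would be a
proper subring of `L` containing `Oᵢ` and `Oₗ`. PROVED.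
[cite: BourbakiAC5to7, Ch. VI §7 no. 2, Th. 1 (proof)] -/
theorem not_qIdeal_le_interIdeal {i l : ι} (hil : i ≠ l) {d : interRing O} (hd0 : (d : L) ≠ 0)
    (hd : d ∈ interIdeal O i) : ¬ qIdeal O i (d : L) ≤ interIdeal O l := by
  haveI : Nonempty ι := ⟨i⟩
  have hO := incomparable_of_independent O hind hne
  intro hle
  set r := (qIdeal O i (d : L)).radical with hr
  have hrprime : r.IsPrime := radical_qIdeal_isPrime O ((mem_interIdeal O).mp hd)
  have hri : r ≤ interIdeal O i :=
    (interIdeal_isPrime O i).radical_le_iff.mpr (qIdeal_le_interIdeal O ((mem_interIdeal O).mp hd))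
  have hrl : r ≤ interIdeal O l := (interIdeal_isPrime O l).radical_le_iff.mpr hle
  -- the local ring `S = B_𝔯 ⊆ L`
  let S : Subring L :=
    { carrier := {x | ∃ y t : interRing O, t ∉ r ∧ x * t = y}
      mul_mem' := by
        rintro x x' ⟨y, t, ht, hxy⟩ ⟨y', t', ht', hxy'⟩
        refine ⟨y * y', t * t', fun h => (hrprime.mem_or_mem h).elim ht ht', ?_⟩
        rw [Subring.coe_mul, Subring.coe_mul, ← hxy, ← hxy']; ring
      one_mem' := ⟨1, 1, fun h => hrprime.ne_top ((Ideal.eq_top_iff_one _).mpr h), by simp⟩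
      add_mem' := by
        rintro x x' ⟨y, t, ht, hxy⟩ ⟨y', t', ht', hxy'⟩
        refine ⟨y * t' + y' * t, t * t', fun h => (hrprime.mem_or_mem h).elim ht ht', ?_⟩
        rw [Subring.coe_add, Subring.coe_mul, Subring.coe_mul, Subring.coe_mul, ← hxy, ← hxy']
        ring
      zero_mem' := ⟨0, 1, fun h => hrprime.ne_top ((Ideal.eq_top_iff_one _).mpr h), by simp⟩
      neg_mem' := by
        rintro x ⟨y, t, ht, hxy⟩
        exact ⟨-y, t, ht, by rw [Subring.coe_neg, ← hxy]; ring⟩ }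
  -- `Oⱼ ⊆ S` for `j = i, l` (Lemma 1: `x = (zx)/z` with `z` a unit at `Oⱼ`, so `z ∉ 𝔭ⱼ ⊇ 𝔯`)
  have hsub : ∀ j, r ≤ interIdeal O j → (O j).toSubring ≤ S := by
    intro j hrj x hx
    obtain ⟨z, hzB, hzxB, hz0, hin, -⟩ := exists_inv_taming O x
    refine ⟨⟨z * x, hzxB⟩, ⟨z, hzB⟩, fun hzr => ?_, mul_comm x z⟩
    have : (O j).valuation z < 1 := (mem_interIdeal O).mp (hrj hzr)
    rw [hin j hx] at this
    exact lt_irrefl _ this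
  let V : ValuationSubring L := (O i).ofLE S (hsub i hri)
  have hiV : O i ≤ V := fun x hx => hsub i hri hx
  have hlV : O l ≤ V := fun x hx => hsub l hrl hx
  have hVtop : V = ⊤ := top_le_iff.mp ((hind i l hil) ▸ sup_le hiV hlV)
  -- but `d⁻¹ ∉ S`
  have hdinv : (d : L)⁻¹ ∈ V := by rw [hVtop]; trivial
  obtain ⟨y, t, ht, hyt⟩ : (d : L)⁻¹ ∈ S := hdinv
  apply ht
  have hteq : t = d * y := by
    apply Subtype.ext
    rw [Subring.coe_mul, ← hyt, ← mul_assoc, mul_inv_cancel₀ hd0, one_mul]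
  have htq : t ∈ qIdeal O i (d : L) := by
    rw [hteq, mem_qIdeal, Subring.coe_mul, map_mul]
    calc (O i).valuation (d : L) * (O i).valuation (y : L) ≤ (O i).valuation (d : L) * 1 := by
          gcongr; exact valuation_coe_le_one O y i
      _ = _ := mul_one _
  exact Ideal.le_radical htq

/-- For pairwise independent `Oᵢ` and `0 ≠ dⱼ ∈ 𝔭ⱼ`, the ideals `𝔮ᵢ`, `𝔮ⱼ` (`i ≠ j`) are
comaximal (Bourbaki, *Alg. Comm.* VI §7 no. 2, proof of Thm. 1). PROVED.
[cite: BourbakiAC5to7, Ch. VI §7 no. 2, Th. 1 (proof)] -/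
theorem qIdeal_sup_qIdeal {i j : ι} (hij : i ≠ j) {d : ι → interRing O}
    (hd0 : ∀ l, ((d l : interRing O) : L) ≠ 0) (hd : ∀ l, d l ∈ interIdeal O l) :
    qIdeal O i (d i : L) ⊔ qIdeal O j (d j : L) = ⊤ := by
  haveI : Nonempty ι := ⟨i⟩
  have hO := incomparable_of_independent O hind hne
  by_contra hne'
  obtain ⟨M, hM, hle⟩ := Ideal.exists_le_maximal _ hne'
  obtain ⟨l, rfl⟩ := exists_eq_interIdeal O M hM
  by_cases hli : l = i
  · subst hli
    exact not_qIdeal_le_interIdeal O hne hind (Ne.symm hij) (hd0 j) (hd j) (le_sup_right.trans hle)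
  · exact not_qIdeal_le_interIdeal O hne hind (Ne.symm hli) (hd0 i) (hd i) (le_sup_left.trans hle)

/-- **Approximation for pairwise independent valuation rings** (Bourbaki, *Alg. Comm.* VI §7
no. 2, Thm. 1, in the form needed for the fundamental inequality): for pairwise independent
proper valuation rings `O₁, …, O_n` of `L`, an index `i` and non-zero `dₗ ∈ L` there is
`u ∈ ⋂ₗ Oₗ` which is a unit at `Oᵢ` and satisfies `|u|ₗ ≤ |dₗ|ₗ` for all `l ≠ i`. PROVED.
[cite: BourbakiAC5to7, Ch. VI §7 no. 2, Th. 1] -/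
theorem exists_unit_valuation_le (i : ι) (d : ι → L) (hd : ∀ l, d l ≠ 0) :
    ∃ u : L, u ∈ interRing O ∧ (O i).valuation u = 1 ∧
      ∀ l, l ≠ i → (O l).valuation u ≤ (O l).valuation (d l) := by
  choose d' hd'0 hd' hd'le using fun l => exists_bound_mem_interIdeal O hne l (hd l)
  obtain ⟨w, hwi, hwl⟩ := exists_sub_one_mem_of_sup_eq_top (fun l => qIdeal O l (d' l : L)) i
    fun l hl => qIdeal_sup_qIdeal O hne hind (Ne.symm hl) hd'0 hd'
  refine ⟨w, w.2, ?_, fun l hl => (mem_qIdeal O).mp (hwl l hl) |>.trans (hd'le l)⟩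
  have hlt : (O i).valuation ((w - 1 : interRing O) : L) < 1 :=
    lt_of_le_of_lt ((mem_qIdeal O).mp hwi) ((mem_interIdeal O).mp (hd' i))
  have : (w : L) = 1 + ((w - 1 : interRing O) : L) := by
    rw [AddSubgroupClass.coe_sub, OneMemClass.coe_one]; ring
  rw [this]
  exact Valuation.map_one_add_of_lt _ hlt

end Independent

end Literature.AlgebraicGeometry.Resolution
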